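import Literature.Analysis.FluidPDE.ExtremeGrowthBounds
import Literature.Analysis.FunctionSpaces.TorusAgmonExplicit
import Literature.Analysis.FunctionSpaces.TorusEnstrophyOrthogonality
import Literature.Analysis.FunctionSpaces.TorusCalculusProofs
import HarnessLib

/-!
# Discharge of `LuDoering2008_enstrophyRate_le`: `dℰ/dt ≤ 27/(8π⁴ν³) ℰ³` on `T³` — PROVED

Analysis/FluidPDE proof file (theorems only: no definitions, no named facts), sibling of
`ExtremeGrowthBounds.lean`, whose NAMED FACT
`Literature.Analysis.FluidPDE.LuDoering2008_enstrophyRate_le` (Lu–Doering 2008, main analytic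
estimate; Doering 2009, eq. (31); Ayala–Protas 2017, eq. (2.7); Ayala 2014, App. A (A.7)–(A.8))
it DISCHARGES:

* `LuDoering2008_enstrophyRate_le_holds : LuDoering2008_enstrophyRate_le` — on the unit 3-torus,
  along every zero-mean classical solution of the unforced Navier–Stokes system on `[a, b]`,
  `a < b`, every one-sided derivative `R` of the enstrophy `ℰ(t) = ½‖∇u(t)‖₂²` within `[a, b]`
  satisfies `R ≤ (27/(8π⁴ν³)) ℰ(t)³`.

The proof is the printed one (Ayala 2014, App. A, pp. 109–112; Doering 2009, §3):
1. the `H¹` balance `dℰ/dt = -ν‖Δu‖₂² + ∫ ⟪(u·∇)u, Δu⟫` (tree: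
   `Torus.IsClassicalNSSolutionOn.hasDerivWithinAt_half_gradNormSq`, and uniqueness of one-sided
   derivatives within `[a, b]`);
2. Cauchy–Schwarz: `∫ ⟪(u·∇)u, Δu⟫ ≤ ‖u‖_∞ ‖∇u‖₂ ‖Δu‖₂`
   (`integral_inner_convect_laplacian_le`, with the pointwise `‖(u·∇)u‖ ≤ |u| |∇u|_F`);
3. Agmon's inequality on `T³` with the explicit constant, `‖u‖_∞ ≤ (√2/π) ‖∇u‖₂^{1/2} ‖Δu‖₂^{1/2}`
   for zero-mean fields (Ayala (A.3); tree: `Torus.norm_pow_four_le_agmon_explicit`,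
   `FunctionSpaces/TorusAgmonExplicit` — where the lattice sums that the printed derivation replaces
   by integrals are bounded rigorously, `FunctionSpaces/TorusAgmonLatticeSumExplicit`);
4. Young's inequality `C a^{3/2} y^{3/2} − ν y² ≤ 27 C⁴ a⁶/(256 ν³)`, `C⁴ = 4/π⁴`, `a = ‖∇u‖₂`,
   `y = ‖Δu‖₂`, and `a² = 2ℰ`: `27 · 4 · 8 ℰ³/(256 π⁴ ν³) = 27 ℰ³/(8π⁴ν³)` (Ayala (A.8);
   `young_quartic_le`, proved as the polynomial AM–GM `(3p + c)⁴ ≥ 256 p³ c`).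

* `Torus.IsClassicalNSSolutionOn.enstrophyRate_le_neg_sq_div_energy_add_cube` — the `K`-form
  with its explicit constant (Ayala 2014, App. A (A.7); Ayala–Protas 2017, eq. (2.6) with `c`
  identified): `R ≤ −ν ℰ²/K + (27/(π⁴ν³)) ℰ³` at times with `K = ½‖u‖₂² > 0` (half the
  dissipation for Young, half bounded below through `‖∇u‖₂⁴ ≤ ‖u‖₂²‖Δu‖₂²`).

The discharge makes the tree's consequences of the fact unconditional: the finite-time majorant
(Ayala–Protas (2.8), `torusEnstrophy_le_luDoeringMajorant`), the energy–enstrophy inequality and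
the small-data bound ((2.10)–(2.12), `inv_torusEnstrophy_sub_inv_le`, `torusEnstrophy_le_of_small`),
the blow-up rate (`ExtremeGrowthBlowupRate`), the value-function bound (`ExtremeGrowthValueFunction`),
the product form (`ExtremeGrowthEnergyEnstrophyProduct`) — feed them `LuDoering2008_enstrophyRate_le_holds`.

## Mathlib / tree search

Tree: `Torus.IsClassicalNSSolutionOn.hasDerivWithinAt_half_gradNormSq` (`TorusClassicalH1Balance`),
`Torus.fderiv_apply_eq_sum_partialDeriv` (`TorusCalculusProofs`),
`Torus.isSmooth_sum_norm_sq_partialDeriv` (`TorusEnstrophyOrthogonality`),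
`Torus.norm_pow_four_le_agmon_explicit` (`TorusAgmonExplicit`), the sibling discharge pattern of
`ExtremeGrowthVorticityControlProofs`. Mathlib: `Real.sum_mul_le_sqrt_mul_sqrt`,
`integral_mul_le_Lp_mul_Lq_of_nonneg`, `EuclideanSpace.norm_eq`, `pow_le_pow_iff_left₀`.

## References

* L. Lu, C. R. Doering, *Limits on enstrophy growth for solutions of the three-dimensional
  Navier–Stokes equations*, Indiana Univ. Math. J. 57 (2008) 2693–2727. [LuDoering2008]
* C. R. Doering, *The 3D Navier–Stokes problem*, Annu. Rev. Fluid Mech. 41 (2009) 109–128, §3.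
  [Doering2009]
* D. Ayala, *Extreme vortex states and singularity formation in incompressible flows*, PhD thesis,
  McMaster Univ. 2014, App. A (A.3), (A.7)–(A.8), pp. 109–112. [Ayala2014Thesis]
* D. Ayala, B. Protas, J. Fluid Mech. 818 (2017) 772–806, eq. (2.7). [AyalaProtas2017]
-/

noncomputable section

open MeasureTheory Set Function Real
open scoped InnerProductSpace RealInnerProductSpace

namespace Literature.Analysis.FluidPDE

open Literature.Analysis.FunctionSpaces

variable {d : Type*} [Fintype d] [DecidableEq d]

/-! ## The pointwise and the integrated Cauchy–Schwarz bounds for the convective term -/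

/-- Pointwise bound of the convective derivative by the Frobenius norm of the gradient:
`‖(u·∇)v (x)‖ ≤ ‖u(x)‖ (∑ᵢ ‖∂ᵢ v(x)‖²)^{1/2}` for `C¹` fields (`Dv(x)h = ∑ᵢ hᵢ ∂ᵢv(x)` and
Cauchy–Schwarz in `ℝ^d`). [folklore] -/
private theorem norm_convect_le_norm_mul_sqrt {u v : UnitAddTorus d → EuclideanSpace ℝ d}
    (hv : Torus.IsSmooth v) (x : UnitAddTorus d) :
    ‖Torus.convect u v x‖ ≤ ‖u x‖ * Real.sqrt (∑ i, ‖Torus.partialDeriv i v x‖ ^ 2) := by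
  have h1 : Torus.convect u v x = ∑ i, (u x) i • Torus.partialDeriv i v x :=
    Torus.fderiv_apply_eq_sum_partialDeriv (hv.isContDiff (by simp)) x (u x)
  rw [h1]
  calc ‖∑ i, (u x) i • Torus.partialDeriv i v x‖
      ≤ ∑ i, ‖(u x) i • Torus.partialDeriv i v x‖ := norm_sum_le _ _
    _ = ∑ i, |(u x) i| * ‖Torus.partialDeriv i v x‖ := by
        refine Finset.sum_congr rfl fun i _ => ?_
        rw [norm_smul, Real.norm_eq_abs]
    _ ≤ Real.sqrt (∑ i, |(u x) i| ^ 2) * Real.sqrt (∑ i, ‖Torus.partialDeriv i v x‖ ^ 2) :=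
        Real.sum_mul_le_sqrt_mul_sqrt _ _ _
    _ = ‖u x‖ * Real.sqrt (∑ i, ‖Torus.partialDeriv i v x‖ ^ 2) := by
        rw [EuclideanSpace.norm_eq]
        simp only [Real.norm_eq_abs]

/-- **Cauchy–Schwarz for the convective term against the Laplacian**: for a smooth field `u` on
`T^d` with `‖u(x)‖ ≤ M` everywhere,
`∫ ⟪(u·∇)u, Δu⟫ ≤ M · (‖∇u‖₂²)^{1/2} · (‖Δu‖₂²)^{1/2}`, `‖∇u‖₂² = Torus.gradNormSq u`
(Doering 2009, §3; Ayala 2014, App. A, proof of (A.7)). [folklore] -/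
private theorem integral_inner_convect_laplacian_le {u : UnitAddTorus d → EuclideanSpace ℝ d}
    (hu : Torus.IsSmooth u) {M : ℝ} (hM0 : 0 ≤ M) (hM : ∀ x, ‖u x‖ ≤ M) :
    ∫ x, ⟪Torus.convect u u x, Torus.laplacian u x⟫_ℝ ≤
      M * Real.sqrt (Torus.gradNormSq u) * Real.sqrt (∫ x, ‖Torus.laplacian u x‖ ^ 2) := by
  set g : UnitAddTorus d → ℝ := fun x => Real.sqrt (∑ i, ‖Torus.partialDeriv i u x‖ ^ 2) with hg_def
  set h : UnitAddTorus d → ℝ := fun x => ‖Torus.laplacian u x‖ with hh_def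
  have hθs : Torus.IsSmooth (fun x => ∑ i, ‖Torus.partialDeriv i u x‖ ^ 2) :=
    Torus.isSmooth_sum_norm_sq_partialDeriv hu
  have hgc : Continuous g := hθs.continuous.sqrt
  have hhc : Continuous h := hu.laplacian.continuous.norm
  have hg0 : ∀ x, 0 ≤ g x := fun x => Real.sqrt_nonneg _
  have hh0 : ∀ x, 0 ≤ h x := fun x => norm_nonneg _
  -- pointwise: `⟪(u·∇)u, Δu⟫ ≤ M g h`
  have hpt : ∀ x, ⟪Torus.convect u u x, Torus.laplacian u x⟫_ℝ ≤ M * (g x * h x) := by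
    intro x
    calc ⟪Torus.convect u u x, Torus.laplacian u x⟫_ℝ
        ≤ ‖Torus.convect u u x‖ * ‖Torus.laplacian u x‖ := real_inner_le_norm _ _
      _ ≤ (‖u x‖ * g x) * h x :=
          mul_le_mul_of_nonneg_right (norm_convect_le_norm_mul_sqrt hu x) (norm_nonneg _)
      _ ≤ (M * g x) * h x :=
          mul_le_mul_of_nonneg_right (mul_le_mul_of_nonneg_right (hM x) (hg0 x)) (hh0 x)
      _ = M * (g x * h x) := by ring
  -- Cauchy–Schwarz in `L²(T^d)`
  have hgm : MemLp g (ENNReal.ofReal 2) volume :=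
    hgc.memLp_of_hasCompactSupport (HasCompactSupport.of_compactSpace g)
  have hhm : MemLp h (ENNReal.ofReal 2) volume :=
    hhc.memLp_of_hasCompactSupport (HasCompactSupport.of_compactSpace h)
  have hcs := integral_mul_le_Lp_mul_Lq_of_nonneg (μ := volume) Real.HolderConjugate.two_two
    (ae_of_all _ hg0) (ae_of_all _ hh0) hgm hhm
  have e1 : ∫ x, g x ^ (2 : ℝ) = Torus.gradNormSq u := by
    rw [Torus.gradNormSq]
    exact integral_congr_ae (ae_of_all _ fun x => by
      dsimp only
      rw [Real.rpow_two, hg_def, Real.sq_sqrt (Finset.sum_nonneg fun i _ => sq_nonneg _)])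
  have e2 : ∫ x, h x ^ (2 : ℝ) = ∫ x, ‖Torus.laplacian u x‖ ^ 2 :=
    integral_congr_ae (ae_of_all _ fun x => by dsimp only; rw [Real.rpow_two])
  rw [e1, e2, ← Real.sqrt_eq_rpow, ← Real.sqrt_eq_rpow] at hcs
  -- integrate the pointwise bound
  have hint1 : Integrable (fun x => ⟪Torus.convect u u x, Torus.laplacian u x⟫_ℝ) volume :=
    ((hu.convect hu).continuous.inner hu.laplacian.continuous).integrable_unitAddTorus
  have hint2 : Integrable (fun x => M * (g x * h x)) volume :=
    ((hgc.mul hhc).integrable_unitAddTorus).const_mul M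
  calc ∫ x, ⟪Torus.convect u u x, Torus.laplacian u x⟫_ℝ
      ≤ ∫ x, M * (g x * h x) := integral_mono hint1 hint2 hpt
    _ = M * ∫ x, g x * h x := integral_const_mul _ _
    _ ≤ M * (Real.sqrt (Torus.gradNormSq u) * Real.sqrt (∫ x, ‖Torus.laplacian u x‖ ^ 2)) :=
        mul_le_mul_of_nonneg_left hcs hM0
    _ = M * Real.sqrt (Torus.gradNormSq u) * Real.sqrt (∫ x, ‖Torus.laplacian u x‖ ^ 2) := by
        ring

/-! ## Young's inequality in polynomial form -/

omit [Fintype d] [DecidableEq d] in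
/-- **The Young/AM–GM step of Lu–Doering** (Ayala 2014, App. A (A.8): "Young's inequality with
`p = 4`, `q = 4/3`"): for `ν > 0`, `a, y, M ≥ 0` with `M⁴ ≤ (4/π⁴) a² y²` (Agmon),
`M a y − ν y² ≤ 27 a⁶/(64 π⁴ ν³)`. Proof without radicals: with `c = 27a⁶/(64π⁴ν³)` and
`p = νy²/3`, `(M a y)⁴ ≤ 4a⁶y⁶/π⁴ = 256 p³ c ≤ (3p + c)⁴ = (νy² + c)⁴` since
`(3p + c)⁴ − 256 p³ c = (p − c)²(81p² + 14pc + c²) ≥ 0`. [folklore] -/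
private theorem young_quartic_le {ν a y M : ℝ} (hν : 0 < ν) (ha : 0 ≤ a) (hy : 0 ≤ y) (hM : 0 ≤ M)
    (hAg : M ^ 4 ≤ 4 / π ^ 4 * a ^ 2 * y ^ 2) :
    M * a * y - ν * y ^ 2 ≤ 27 * a ^ 6 / (64 * π ^ 4 * ν ^ 3) := by
  have hπ : 0 < π := Real.pi_pos
  set c : ℝ := 27 * a ^ 6 / (64 * π ^ 4 * ν ^ 3) with hc
  have hc0 : 0 ≤ c := by positivity
  set p : ℝ := ν * y ^ 2 / 3 with hp
  have hp0 : 0 ≤ p := by positivity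
  -- AM–GM in polynomial form
  have hamgm : 256 * p ^ 3 * c ≤ (3 * p + c) ^ 4 := by
    have hid : (3 * p + c) ^ 4 - 256 * p ^ 3 * c = (p - c) ^ 2 * (81 * p ^ 2 + 14 * p * c + c ^ 2) := by
      ring
    have hnn : 0 ≤ (p - c) ^ 2 * (81 * p ^ 2 + 14 * p * c + c ^ 2) := by positivity
    linarith
  -- `(M a y)⁴ ≤ 256 p³ c`
  have hP4 : (M * a * y) ^ 4 ≤ 256 * p ^ 3 * c := by
    have e : 256 * p ^ 3 * c = 4 / π ^ 4 * a ^ 2 * y ^ 2 * (a ^ 4 * y ^ 4) := by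
      rw [hp, hc]; field_simp; ring
    rw [e, show (M * a * y) ^ 4 = M ^ 4 * (a ^ 4 * y ^ 4) by ring]
    exact mul_le_mul_of_nonneg_right hAg (by positivity)
  have h3p : 3 * p + c = ν * y ^ 2 + c := by rw [hp]; ring
  have hle4 : (M * a * y) ^ 4 ≤ (ν * y ^ 2 + c) ^ 4 := by rw [← h3p]; exact hP4.trans hamgm
  have hMay : 0 ≤ M * a * y := by positivity
  have hrhs : 0 ≤ ν * y ^ 2 + c := by positivity
  have hle : M * a * y ≤ ν * y ^ 2 + c := (pow_le_pow_iff_left₀ hMay hrhs (by norm_num)).1 hle4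
  linarith

/-! ## The discharge -/

/-- **Discharge of `LuDoering2008_enstrophyRate_le`** (Lu–Doering 2008; Doering 2009, §3;
Ayala–Protas 2017, eq. (2.7); the printed derivation is Ayala 2014, App. A (A.3), (A.7)–(A.8)):
on the unit 3-torus, along a zero-mean classical solution of the unforced Navier–Stokes system
on `[a, b]`, `a < b`, every one-sided derivative `R` of `t ↦ ℰ(u(t))` within `[a, b]` satisfies
`R ≤ (27/(8π⁴ν³)) ℰ(u(t))³`. Steps: `R = -ν‖Δu‖₂² + ∫⟪(u·∇)u, Δu⟫` (the `H¹` balance),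
`∫⟪(u·∇)u, Δu⟫ ≤ ‖u‖_∞ ‖∇u‖₂ ‖Δu‖₂`, the explicit Agmon inequality
`‖u‖_∞⁴ ≤ (4/π⁴) ‖∇u‖₂² ‖Δu‖₂²`, and Young's inequality; `‖∇u‖₂² = 2ℰ`.
[cite: LuDoering2008, main estimate; Ayala2014Thesis, App. A (A.7)–(A.8)] -/
theorem LuDoering2008_enstrophyRate_le_holds : LuDoering2008_enstrophyRate_le (d := d) := by
  intro hd ν hν a b hab u p hsol hmean t ht R hR
  have hut : Torus.IsSmooth (u t) := hsol.smooth_velocity.isSmooth_slice ht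
  have hπ : 0 < π := Real.pi_pos
  -- Step 1: identify `R` with the `H¹` balance rate
  have hbal := hsol.hasDerivWithinAt_half_gradNormSq hab ht
  have hU : UniqueDiffWithinAt ℝ (Icc a b) t := uniqueDiffOn_Icc hab t ht
  have hR' : HasDerivWithinAt (fun s => 2⁻¹ * Torus.gradNormSq (u s)) R (Icc a b) t := hR
  have hReq : R = -ν * (∫ x, ‖Torus.laplacian (u t) x‖ ^ 2) +
      ∫ x, ⟪Torus.convect (u t) (u t) x - (0 : ℝ → UnitAddTorus d → EuclideanSpace ℝ d) t x,
        Torus.laplacian (u t) x⟫_ℝ :=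
    (hR'.derivWithin hU).symm.trans (hbal.derivWithin hU)
  have hconv : ∫ x, ⟪Torus.convect (u t) (u t) x - (0 : ℝ → UnitAddTorus d → EuclideanSpace ℝ d) t x,
        Torus.laplacian (u t) x⟫_ℝ =
      ∫ x, ⟪Torus.convect (u t) (u t) x, Torus.laplacian (u t) x⟫_ℝ := by
    refine integral_congr_ae (Filter.Eventually.of_forall fun x => ?_)
    simp only [Pi.zero_apply, sub_zero]
  -- Step 2: the quantities `A2 = ‖∇u‖₂²`, `B2 = ‖Δu‖₂²`, the sup bound `M`
  obtain ⟨A2, hA2⟩ : ∃ A2 : ℝ, A2 = Torus.gradNormSq (u t) := ⟨_, rfl⟩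
  obtain ⟨B2, hB2⟩ : ∃ B2 : ℝ, B2 = ∫ x, ‖Torus.laplacian (u t) x‖ ^ 2 := ⟨_, rfl⟩
  have hA0 : 0 ≤ A2 := by rw [hA2, Torus.gradNormSq]; positivity
  have hB0 : 0 ≤ B2 := by rw [hB2]; positivity
  set aa : ℝ := Real.sqrt A2 with haa
  set yy : ℝ := Real.sqrt B2 with hyy
  have haa0 : 0 ≤ aa := Real.sqrt_nonneg _
  have hyy0 : 0 ≤ yy := Real.sqrt_nonneg _
  -- Agmon: `‖u(t,x)‖⁴ ≤ (4/π⁴) A2 B2`; put `M = ((4/π⁴) A2 B2)^{1/4}` via square roots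
  set m4 : ℝ := 4 / π ^ 4 * A2 * B2 with hm4
  have hm40 : 0 ≤ m4 := by positivity
  set M : ℝ := Real.sqrt (Real.sqrt m4) with hMdef
  have hM0 : 0 ≤ M := Real.sqrt_nonneg _
  have hM4 : M ^ 4 = m4 := by
    rw [show (4 : ℕ) = 2 * 2 by norm_num, pow_mul, hMdef, Real.sq_sqrt (Real.sqrt_nonneg _),
      Real.sq_sqrt hm40]
  have hMx : ∀ x, ‖u t x‖ ≤ M := by
    intro x
    have h4 := Torus.norm_pow_four_le_agmon_explicit hd hut (hmean t ht) x
    rw [← hA2, ← hB2] at h4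
    have h4' : ‖u t x‖ ^ 4 ≤ M ^ 4 := by rw [hM4, hm4]; exact h4
    exact (pow_le_pow_iff_left₀ (norm_nonneg _) hM0 (by norm_num)).1 h4'
  have hAg : M ^ 4 ≤ 4 / π ^ 4 * aa ^ 2 * yy ^ 2 := by
    rw [hM4, hm4, haa, hyy, Real.sq_sqrt hA0, Real.sq_sqrt hB0]
  -- Step 3: Cauchy–Schwarz for the convective term
  have hCS : ∫ x, ⟪Torus.convect (u t) (u t) x, Torus.laplacian (u t) x⟫_ℝ ≤ M * aa * yy := by
    have h := integral_inner_convect_laplacian_le hut hM0 hMx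
    rw [← hA2, ← hB2] at h
    exact h
  -- Step 4: Young
  have hyoung := young_quartic_le hν haa0 hyy0 hM0 hAg
  have hB2' : ν * yy ^ 2 = ν * B2 := by rw [hyy, Real.sq_sqrt hB0]
  have hE : torusEnstrophy (u t) = A2 / 2 := by
    rw [torusEnstrophy, hA2]; ring
  have ha6 : aa ^ 6 = A2 ^ 3 := by
    rw [show (6 : ℕ) = 2 * 3 by norm_num, pow_mul, haa, Real.sq_sqrt hA0]
  calc R = -ν * B2 + ∫ x, ⟪Torus.convect (u t) (u t) x, Torus.laplacian (u t) x⟫_ℝ := by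
        rw [hReq, hconv, hB2]
    _ ≤ -ν * B2 + M * aa * yy := by linarith [hCS]
    _ = M * aa * yy - ν * yy ^ 2 := by rw [hB2']; ring
    _ ≤ 27 * aa ^ 6 / (64 * π ^ 4 * ν ^ 3) := hyoung
    _ = luDoeringConst ν * torusEnstrophy (u t) ^ 3 := by
        rw [ha6, hE, luDoeringConst]
        field_simp
        ring


/-! ## The `K`-form with the explicit constant (Ayala 2014, (A.7); Ayala–Protas 2017, (2.6)) -/

/-- The interpolation inequality `‖∇v‖₂⁴ ≤ ‖v‖₂² ‖Δv‖₂²` for smooth real fields on `T^d`, i.e.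
`(Torus.gradNormSq v)² ≤ (∫‖v‖²)(∫‖Δv‖²)` (Parseval: `(∑ μₖ‖v̂ₖ‖²)² ≤ ∑‖v̂ₖ‖² · ∑ μₖ²‖v̂ₖ‖²`,
`μₖ = 4π²|k|²`; Ayala 2014, App. A: "integration by parts and the Cauchy–Schwarz inequality imply
`‖∇u‖₂² ≤ ‖u‖₂‖Δu‖₂`"). [folklore] -/
private theorem gradNormSq_sq_le_integral_mul_integral {v : UnitAddTorus d → EuclideanSpace ℝ d}
    (hv : Torus.IsSmooth v) :
    Torus.gradNormSq v ^ 2 ≤ (∫ y, ‖v y‖ ^ 2) * ∫ y, ‖Torus.laplacian v y‖ ^ 2 := by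
  classical
  have hA := Torus.hasSum_freq_mul_norm_sq_mFourierCoeff hv
  have hB := Torus.hasSum_freq_sq_mul_norm_sq_mFourierCoeff hv
  have hK := Torus.hasSum_sq_norm_mFourierCoeff_complexify (hv.memLp 2)
  let f : (d → ℤ) → ℝ := fun k => ‖UnitAddTorus.mFourierCoeff (EuclideanSpace.complexify ∘ v) k‖
  let g : (d → ℤ) → ℝ := fun k =>
    4 * π ^ 2 * Torus.freqNormSq k * ‖UnitAddTorus.mFourierCoeff (EuclideanSpace.complexify ∘ v) k‖
  have hf0 : ∀ k, 0 ≤ f k := fun k => norm_nonneg _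
  have hg0 : ∀ k, 0 ≤ g k := fun k => by
    have := Torus.freqNormSq_nonneg k; positivity
  have hf2 : HasSum (fun k => f k ^ (2 : ℝ)) (∫ y, ‖v y‖ ^ 2) :=
    hK.congr_fun fun k => by simp only [f, Real.rpow_two]
  have hg2 : HasSum (fun k => g k ^ (2 : ℝ)) (∫ y, ‖Torus.laplacian v y‖ ^ 2) :=
    hB.congr_fun fun k => by simp only [g, Real.rpow_two]; ring
  have hfg : HasSum (fun k => f k * g k) (Torus.gradNormSq v) :=
    hA.congr_fun fun k => by simp only [f, g]; ring
  have hCS := Real.inner_le_Lp_mul_Lq_tsum_of_nonneg Real.HolderConjugate.two_two hf0 hg0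
    hf2.summable hg2.summable
  rw [hfg.tsum_eq, hf2.tsum_eq, hg2.tsum_eq] at hCS
  have h0 : 0 ≤ Torus.gradNormSq v := by rw [Torus.gradNormSq]; positivity
  have hX : 0 ≤ ∫ y, ‖v y‖ ^ 2 := by positivity
  have hY : 0 ≤ ∫ y, ‖Torus.laplacian v y‖ ^ 2 := by positivity
  have h2 := pow_le_pow_left₀ h0 hCS 2
  refine h2.trans (le_of_eq ?_)
  rw [mul_pow, ← Real.sqrt_eq_rpow, ← Real.sqrt_eq_rpow, Real.sq_sqrt hX, Real.sq_sqrt hY]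

/-- **The `K`-form of the enstrophy estimate with its explicit constant** (Ayala 2014, App. A
(A.7): `dE/dt ≤ −νE²/K + 27C⁴E³/(4ν³)`, `C = √2/π`, i.e. `27/(π⁴ν³)`; Ayala–Protas 2017, eq. (2.6)
with the constant identified; Doering 2009, §3): on the unit 3-torus, along a zero-mean classical
solution of the unforced Navier–Stokes system on `[a, b]`, `a < b`, at a time with `K(u(t)) > 0`,
every one-sided derivative `R` of `t ↦ ℰ(u(t))` within `[a, b]` satisfies
`R ≤ −ν ℰ²/K + (27/(π⁴ν³)) ℰ³`, `K = ½‖u‖₂²`, `ℰ = ½‖∇u‖₂²`. Proof: half of the dissipation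
is spent on Young's inequality (`M a y − (ν/2) y² ≤ 27 a⁶/(8π⁴ν³)`), the other half is bounded
below by `‖Δu‖₂² ≥ ‖∇u‖₂⁴/‖u‖₂² = 2ℰ²/K`. [cite: Ayala2014Thesis, App. A (A.7)] -/
theorem _root_.Literature.Analysis.FunctionSpaces.Torus.IsClassicalNSSolutionOn.enstrophyRate_le_neg_sq_div_energy_add_cube
    (hd : Fintype.card d = 3) {ν a b : ℝ} (hν : 0 < ν) (hab : a < b)
    {u : ℝ → UnitAddTorus d → EuclideanSpace ℝ d} {p : ℝ → UnitAddTorus d → ℝ}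
    (hsol : Torus.IsClassicalNSSolutionOn (Icc a b) ν 0 u p)
    (hmean : ∀ t ∈ Icc a b, Torus.HasZeroMean (u t)) {t : ℝ} (ht : t ∈ Icc a b)
    (hK : 0 < Torus.kineticEnergy (u t)) {R : ℝ}
    (hR : HasDerivWithinAt (fun s => torusEnstrophy (u s)) R (Icc a b) t) :
    R ≤ -ν * torusEnstrophy (u t) ^ 2 / Torus.kineticEnergy (u t) +
      27 / (π ^ 4 * ν ^ 3) * torusEnstrophy (u t) ^ 3 := by
  have hut : Torus.IsSmooth (u t) := hsol.smooth_velocity.isSmooth_slice ht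
  have hπ : 0 < π := Real.pi_pos
  -- `R = -ν‖Δu‖₂² + ∫⟪(u·∇)u, Δu⟫`
  have hbal := hsol.hasDerivWithinAt_half_gradNormSq hab ht
  have hU : UniqueDiffWithinAt ℝ (Icc a b) t := uniqueDiffOn_Icc hab t ht
  have hR' : HasDerivWithinAt (fun s => 2⁻¹ * Torus.gradNormSq (u s)) R (Icc a b) t := hR
  have hReq : R = -ν * (∫ x, ‖Torus.laplacian (u t) x‖ ^ 2) +
      ∫ x, ⟪Torus.convect (u t) (u t) x - (0 : ℝ → UnitAddTorus d → EuclideanSpace ℝ d) t x,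
        Torus.laplacian (u t) x⟫_ℝ :=
    (hR'.derivWithin hU).symm.trans (hbal.derivWithin hU)
  have hconv : ∫ x, ⟪Torus.convect (u t) (u t) x - (0 : ℝ → UnitAddTorus d → EuclideanSpace ℝ d) t x,
        Torus.laplacian (u t) x⟫_ℝ =
      ∫ x, ⟪Torus.convect (u t) (u t) x, Torus.laplacian (u t) x⟫_ℝ := by
    refine integral_congr_ae (Filter.Eventually.of_forall fun x => ?_)
    simp only [Pi.zero_apply, sub_zero]
  obtain ⟨A2, hA2⟩ : ∃ A2 : ℝ, A2 = Torus.gradNormSq (u t) := ⟨_, rfl⟩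
  obtain ⟨B2, hB2⟩ : ∃ B2 : ℝ, B2 = ∫ x, ‖Torus.laplacian (u t) x‖ ^ 2 := ⟨_, rfl⟩
  obtain ⟨K2, hK2⟩ : ∃ K2 : ℝ, K2 = ∫ x, ‖u t x‖ ^ 2 := ⟨_, rfl⟩
  have hA0 : 0 ≤ A2 := by rw [hA2, Torus.gradNormSq]; positivity
  have hB0 : 0 ≤ B2 := by rw [hB2]; positivity
  have hKE : Torus.kineticEnergy (u t) = K2 / 2 := by rw [Torus.kineticEnergy, hK2]; ring
  have hK20 : 0 < K2 := by
    have : 0 < K2 / 2 := by rw [← hKE]; exact hK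
    linarith
  set aa : ℝ := Real.sqrt A2 with haa
  set yy : ℝ := Real.sqrt B2 with hyy
  have haa0 : 0 ≤ aa := Real.sqrt_nonneg _
  have hyy0 : 0 ≤ yy := Real.sqrt_nonneg _
  -- Agmon and the sup bound
  set m4 : ℝ := 4 / π ^ 4 * A2 * B2 with hm4
  have hm40 : 0 ≤ m4 := by positivity
  set M : ℝ := Real.sqrt (Real.sqrt m4) with hMdef
  have hM0 : 0 ≤ M := Real.sqrt_nonneg _
  have hM4 : M ^ 4 = m4 := by
    rw [show (4 : ℕ) = 2 * 2 by norm_num, pow_mul, hMdef, Real.sq_sqrt (Real.sqrt_nonneg _),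
      Real.sq_sqrt hm40]
  have hMx : ∀ x, ‖u t x‖ ≤ M := by
    intro x
    have h4 := Torus.norm_pow_four_le_agmon_explicit hd hut (hmean t ht) x
    rw [← hA2, ← hB2] at h4
    have h4' : ‖u t x‖ ^ 4 ≤ M ^ 4 := by rw [hM4, hm4]; exact h4
    exact (pow_le_pow_iff_left₀ (norm_nonneg _) hM0 (by norm_num)).1 h4'
  have hAg : M ^ 4 ≤ 4 / π ^ 4 * aa ^ 2 * yy ^ 2 := by
    rw [hM4, hm4, haa, hyy, Real.sq_sqrt hA0, Real.sq_sqrt hB0]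
  have hCS : ∫ x, ⟪Torus.convect (u t) (u t) x, Torus.laplacian (u t) x⟫_ℝ ≤ M * aa * yy := by
    have h := integral_inner_convect_laplacian_le hut hM0 hMx
    rw [← hA2, ← hB2] at h
    exact h
  -- Young with half the viscosity
  have hν2 : 0 < ν / 2 := by linarith
  have hyoung := young_quartic_le hν2 haa0 hyy0 hM0 hAg
  have hyy2 : yy ^ 2 = B2 := by rw [hyy, Real.sq_sqrt hB0]
  have ha6 : aa ^ 6 = A2 ^ 3 := by
    rw [show (6 : ℕ) = 2 * 3 by norm_num, pow_mul, haa, Real.sq_sqrt hA0]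
  -- the other half of the dissipation: `B2 ≥ A2²/K2`
  have hinterp : A2 ^ 2 ≤ K2 * B2 := by
    rw [hA2, hK2, hB2]; exact gradNormSq_sq_le_integral_mul_integral hut
  have hB2lb : A2 ^ 2 / K2 ≤ B2 := by rw [div_le_iff₀ hK20]; linarith
  have hE : torusEnstrophy (u t) = A2 / 2 := by rw [torusEnstrophy, hA2]; ring
  -- assemble
  have h1 : R = -(ν / 2) * B2 + (M * aa * yy - ν / 2 * yy ^ 2)
      + ((∫ x, ⟪Torus.convect (u t) (u t) x, Torus.laplacian (u t) x⟫_ℝ) - M * aa * yy) := by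
    rw [hReq, hconv, ← hB2, hyy2]; ring
  have h2 : -(ν / 2) * B2 ≤ -(ν / 2) * (A2 ^ 2 / K2) := by nlinarith [hB2lb]
  calc R ≤ -(ν / 2) * (A2 ^ 2 / K2) + 27 * aa ^ 6 / (64 * π ^ 4 * (ν / 2) ^ 3) := by
        rw [h1]; linarith [hCS, hyoung, h2]
    _ = -ν * torusEnstrophy (u t) ^ 2 / Torus.kineticEnergy (u t) +
          27 / (π ^ 4 * ν ^ 3) * torusEnstrophy (u t) ^ 3 := by
        rw [ha6, hE, hKE]
        field_simp
        ring

end Literature.Analysis.FluidPDE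

end
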